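import Summits.ValiantsHypothesis.ValiantsHypothesis.Theorems.BarrierLeverChowThinRowsStarColumnsPrelims

/-!
# Route BarrierLever — item `ChowHitsThinRowPartitionMinors` (stmt-ValiantsHypothesis-20195):
# DOUBLED PURE FACTORS — the powerset form of the partition table, and the subset-sum identities

Helper file (`--supports stmt-ValiantsHypothesis-20195`; cell valiant-natproofs, rung V4, 𝒟-side of
door (c); prover seat val-np-p8 gen 2).  Closes NO item; imports `…ChowThinRowsStarColumnsPrelims` (val-np-p8 g2;
only `ChowFactor.coeff_partitionExpo_mul_affineY` is used); no route file, no definitions.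

Bookkeeping for the «doubled pure factor» designs of HOME/val-np-p8/MEMO-pairlayer-g2.md §1c (Hamming-ball
/ co-star columns: multiplying a witness `F` by extra pure factors `∏_{c ∈ D} (1 + y_c)` makes the
Hadamard coefficient of the pair rows tunable):
* `coeff_mul_prod_pureY` — `coeff (E u W) (F · ∏_{c∈D} (1 + y_c)) = Σ_{S ⊆ W ∩ D} coeff (E u (W ∖ S)) F`;
* `two_mul_sum_powerset_sum` — `2 · Σ_{S ⊆ T} Σ_{c ∈ S} f c = 2^{|T|} · Σ_{c∈T} f c`;
* `four_mul_sum_powerset_sum_mul_sum` — `4 · Σ_{S ⊆ T} (Σ_{c∈S} f c)(Σ_{c∈S} g c) = 2^{|T|} · ((Σ_T f)(Σ_T g) + Σ_T f·g)`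
  (first and second moments of subset sums); with `…SingletonDesignEntries` these give the rows of the
  doubled design in closed form (`2^{|W∩D|} ×` a quadratic polynomial whose Hadamard coefficient is `3`).

WHAT THIS IS NOT: bookkeeping only; nothing on items 20195 / 20172 / 19717 themselves, on crux
stmt-ValiantsHypothesis-14610, or on `VP` versus `VNP`.
-/

set_option linter.dupNamespace false

namespace Summit.ValiantsHypothesis.ValiantsHypothesis.Theorems.BarrierLever.ChowSubcube

open Finset MvPolynomial
open Summit.ValiantsHypothesis.ValiantsHypothesis.Theorems.BarrierLever.ChowFactor
  (coeff_partitionExpo_mul_affineY)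

variable {h : ℕ}

/-- **Powerset form of the table after doubling pure factors**: multiplying by `∏_{c ∈ D} (1 + y_c)`
replaces the entry at column `W` by the sum of the entries at the columns `W ∖ S`, `S ⊆ W ∩ D`. -/
theorem coeff_mul_prod_pureY (F : MvPolynomial (Fin (h + h)) ℂ) (u W D : Finset (Fin h)) :
    coeff (∑ a ∈ u, Finsupp.single (Fin.castAdd h a) 1 + ∑ c ∈ W, Finsupp.single (Fin.natAdd h c) 1)
        (F * ∏ c ∈ D, (C 1 + X (Fin.natAdd h c))) =
      ∑ S ∈ (W ∩ D).powerset, coeff (∑ a ∈ u, Finsupp.single (Fin.castAdd h a) 1 +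
        ∑ c ∈ W \ S, Finsupp.single (Fin.natAdd h c) 1) F := by
  classical
  induction D using Finset.induction_on generalizing W with
  | empty =>
    rw [Finset.prod_empty, mul_one, Finset.inter_empty, Finset.powerset_empty, Finset.sum_singleton,
      Finset.sdiff_empty]
  | insert c D hc ih =>
    -- `F · ∏_{insert c D} = (F · ∏_D) · (1 + y_c)`
    have hform : (C 1 + X (Fin.natAdd h c) : MvPolynomial (Fin (h + h)) ℂ) =
        1 + ∑ c', C (if c' = c then (1 : ℂ) else 0) * X (Fin.natAdd h c') := by
      rw [C_1]
      congr 1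
      rw [Finset.sum_eq_single c (fun c' _ hc' => by rw [if_neg hc', C_0, zero_mul])
        (fun hh => absurd (Finset.mem_univ c) hh), if_pos rfl, C_1, one_mul]
    rw [Finset.prod_insert hc, mul_comm (C 1 + X (Fin.natAdd h c)) _, ← mul_assoc, hform,
      coeff_partitionExpo_mul_affineY, ih W]
    have hstep : ∑ c' ∈ W, (if c' = c then (1 : ℂ) else 0) *
        coeff (∑ a ∈ u, Finsupp.single (Fin.castAdd h a) 1 +
          ∑ c'' ∈ W.erase c', Finsupp.single (Fin.natAdd h c'') 1) (F * ∏ c ∈ D, (C 1 + X (Fin.natAdd h c))) =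
        if c ∈ W then coeff (∑ a ∈ u, Finsupp.single (Fin.castAdd h a) 1 +
          ∑ c'' ∈ W.erase c, Finsupp.single (Fin.natAdd h c'') 1) (F * ∏ c ∈ D, (C 1 + X (Fin.natAdd h c)))
        else 0 := by
      simp only [ite_mul, one_mul, zero_mul, Finset.sum_ite_eq']
    rw [hstep]
    by_cases hcW : c ∈ W
    · rw [if_pos hcW, ih (W.erase c)]
      have e1 : W ∩ insert c D = insert c (W ∩ D) := by
        rw [Finset.inter_insert_of_mem hcW]
      have e2 : W.erase c ∩ D = W ∩ D := by
        ext x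
        simp only [Finset.mem_inter, Finset.mem_erase]
        constructor
        · rintro ⟨⟨-, hx⟩, hxD⟩; exact ⟨hx, hxD⟩
        · rintro ⟨hx, hxD⟩; exact ⟨⟨fun e => hc (e ▸ hxD), hx⟩, hxD⟩
      have hcWD : c ∉ W ∩ D := fun hm => hc (Finset.mem_inter.mp hm).2
      rw [e1, e2, Finset.sum_powerset_insert hcWD]
      congr 1
      refine Finset.sum_congr rfl fun S _ => ?_
      have eS : W.erase c \ S = W \ insert c S := by
        ext x
        simp only [Finset.mem_sdiff, Finset.mem_erase, Finset.mem_insert, not_or]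
        tauto
      rw [eS]
    · rw [if_neg hcW, add_zero, Finset.inter_insert_of_notMem hcW]

/-- **First moment of subset sums**: `2 · Σ_{S ⊆ T} Σ_{c ∈ S} f c = 2^{|T|} · Σ_{c ∈ T} f c`. -/
theorem two_mul_sum_powerset_sum (T : Finset (Fin h)) (f : Fin h → ℂ) :
    2 * ∑ S ∈ T.powerset, ∑ c ∈ S, f c = 2 ^ T.card * ∑ c ∈ T, f c := by
  classical
  induction T using Finset.induction_on with
  | empty => simp
  | insert a T ha ih =>
    rw [Finset.sum_powerset_insert ha, Finset.card_insert_of_notMem ha, Finset.sum_insert ha]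
    have hin : ∑ S ∈ T.powerset, ∑ c ∈ insert a S, f c = ∑ S ∈ T.powerset, (f a + ∑ c ∈ S, f c) := by
      refine Finset.sum_congr rfl fun S hS => ?_
      rw [Finset.sum_insert (fun hm => ha (Finset.mem_powerset.mp hS hm))]
    rw [hin, Finset.sum_add_distrib, Finset.sum_const, Finset.card_powerset, nsmul_eq_mul]
    push_cast
    have e : (2 : ℂ) * (∑ S ∈ T.powerset, ∑ c ∈ S, f c + ((2 : ℂ) ^ T.card * f a + ∑ S ∈ T.powerset, ∑ c ∈ S, f c)) =
        2 * (2 * ∑ S ∈ T.powerset, ∑ c ∈ S, f c) + 2 * 2 ^ T.card * f a := by ring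
    rw [e, ih]
    ring

/-- **Second moment of subset sums**:
`4 · Σ_{S ⊆ T} (Σ_{c∈S} f c)(Σ_{c∈S} g c) = 2^{|T|} · ((Σ_T f)(Σ_T g) + Σ_{c∈T} f c · g c)`. -/
theorem four_mul_sum_powerset_sum_mul_sum (T : Finset (Fin h)) (f g : Fin h → ℂ) :
    4 * ∑ S ∈ T.powerset, (∑ c ∈ S, f c) * (∑ c ∈ S, g c) =
      2 ^ T.card * ((∑ c ∈ T, f c) * (∑ c ∈ T, g c) + ∑ c ∈ T, f c * g c) := by
  classical
  induction T using Finset.induction_on with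
  | empty => simp
  | insert a T ha ih =>
    rw [Finset.sum_powerset_insert ha, Finset.card_insert_of_notMem ha, Finset.sum_insert ha,
      Finset.sum_insert ha, Finset.sum_insert ha]
    have hin : ∑ S ∈ T.powerset, (∑ c ∈ insert a S, f c) * (∑ c ∈ insert a S, g c) =
        ∑ S ∈ T.powerset, ((f a * g a + f a * ∑ c ∈ S, g c + g a * ∑ c ∈ S, f c) +
          (∑ c ∈ S, f c) * (∑ c ∈ S, g c)) := by
      refine Finset.sum_congr rfl fun S hS => ?_
      have haS : a ∉ S := fun hm => ha (Finset.mem_powerset.mp hS hm)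
      rw [Finset.sum_insert haS, Finset.sum_insert haS]
      ring
    rw [hin, Finset.sum_add_distrib, Finset.sum_add_distrib, Finset.sum_add_distrib, Finset.sum_const,
      Finset.card_powerset, nsmul_eq_mul, ← Finset.mul_sum, ← Finset.mul_sum]
    push_cast
    have h2f := two_mul_sum_powerset_sum T f
    have h2g := two_mul_sum_powerset_sum T g
    -- assemble: 4·(old + new) with the first moments replaced
    have e : (4 : ℂ) * (∑ S ∈ T.powerset, (∑ c ∈ S, f c) * (∑ c ∈ S, g c) +
        ((2 : ℂ) ^ T.card * (f a * g a) + f a * ∑ S ∈ T.powerset, ∑ c ∈ S, g c +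
          g a * ∑ S ∈ T.powerset, ∑ c ∈ S, f c + ∑ S ∈ T.powerset, (∑ c ∈ S, f c) * (∑ c ∈ S, g c))) =
        2 * (4 * ∑ S ∈ T.powerset, (∑ c ∈ S, f c) * (∑ c ∈ S, g c)) + 4 * 2 ^ T.card * (f a * g a) +
          2 * f a * (2 * ∑ S ∈ T.powerset, ∑ c ∈ S, g c) + 2 * g a * (2 * ∑ S ∈ T.powerset, ∑ c ∈ S, f c) := by
      ring
    rw [e, ih, h2f, h2g]
    ring

end Summit.ValiantsHypothesis.ValiantsHypothesis.Theorems.BarrierLever.ChowSubcube
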